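import Mathlib.Analysis.SpecialFunctions.SmoothTransition
import Mathlib.Analysis.SpecialFunctions.Sqrt
import Literature.Geometry.Lorentzian.KerrSchildMultiplierCurrent
import Literature.Geometry.Lorentzian.KerrSchildKillingEnergy
import Literature.Geometry.Lorentzian.MinkowskiRadialMultiplier
import Summits.FinalStateConjecture.FinalStateConjecture.Theorems.ClusterCompletenessAdiabaticMultiKerrILEDTailsCutStationary
import Summits.FinalStateConjecture.FinalStateConjecture.Theorems.ClusterCompletenessAdiabaticMultiKerrILEDHardyCurrent
import Summits.FinalStateConjecture.FinalStateConjecture.Theorems.ClusterCompletenessAdiabaticMultiKerrILEDMorawetzWeight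
import Summits.FinalStateConjecture.FinalStateConjecture.Theorems.ClusterCompletenessAdiabaticMultiKerrILEDSmoothTransitionSlope
import Summits.FinalStateConjecture.FinalStateConjecture.Theorems.ClusterCompletenessAdiabaticMultiKerrILEDFarPointwise

/-!
# Crux `AdiabaticMultiKerrILED` (line `Sketch`) — the static cut-off layer of the degenerate
# Morawetz estimate

Helper file for the crux `stmt-FinalStateConjecture-14310`
(`Summit.FinalStateConjecture.FinalStateConjecture.Theses.ClusterCompleteness.AdiabaticMultiKerrILED`),
line `Sketch`, stub `morawetz_staticLayer_abs_le` (lead c7, wave 5, Morawetz integration).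

The weighted divergence identity for the total Morawetz current `J_tot = J^X + ¼ L^{ϖ₂} + J_H + J^T`
of the static tails-cut Schwarzschild zone (rest frame, `G₀ = η⁻¹ − χ(r)·2H ℓ♯ ⊗ ℓ♯`,
`χ(r) = Real.smoothTransition (2 − r/(8M))`, `r = Kerr.radius 0 = ‖x⃗‖`) is localised in space with
the STATIC cut-off `W_R(y) = Real.smoothTransition (2 − ‖y⃗‖²/R²)`, `R ≥ 16M`. Its gradient is
supported in `{R ≤ ‖y⃗‖}` and bounded by `16/R` (`morawetz_abs_fderiv_staticCutoff_le`); there the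
zone is FLAT (`χ(r) = 0`: `G₀ = η⁻¹`, `|X^α| ≤ 1` for `X = (1 − 3M/r)∂_{r*}`, the Hardy profile
vanishes, `|ϖ₂(r)| ≤ 6/r`, `|ϖ₂′(r)| ≤ 8/r²`), whence the flat-space pointwise bound
`|J_tot^μ| ≤ 8 ∑_κ (∂_κΦ)² + (6² + 8)/8 · Φ²/r²` (`morawetz_abs_totalCurrent_flat_le`) and the
registered stub `morawetz_staticLayer_abs_le`:
`|∑_μ ∂_μ W_R · J_tot^μ| ≤ K/R · (∑_κ (∂_κΦ)² + Φ²/r²)`, `K = 864`. [folklore]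
-/

noncomputable section

-- the doubled `FinalStateConjecture.FinalStateConjecture` path component trips dupNamespace
set_option linter.dupNamespace false

open scoped ContDiff Topology BigOperators
open Filter Set Literature.Geometry.Lorentzian
open Summit.FinalStateConjecture.FinalStateConjecture.Cruxes.AdiabaticMultiKerrILED.Sketch
  (abs_multiplierCurrent_eta_le abs_lagrangianCurrent_eta_le)

namespace Summit.FinalStateConjecture.FinalStateConjecture.Theorems

/-! ### Coordinates -/

/-- `|x^{i+1}| ≤ r(x)` for a spatial coordinate (`r = ‖x⃗‖` at `a = 0`). [folklore] -/
theorem morawetz_abs_apply_succ_le_radius (x : E4) (i : Fin 3) : |x i.succ| ≤ Kerr.radius 0 x := by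
  rw [Kerr.radius_zero_left]
  have h := PiLp.norm_apply_le (E4.spatial x) i
  rwa [E4.spatial_apply, Real.norm_eq_abs] at h

/-! ### The static cut-off `W_R` -/

/-- **Gradient bound for the static cut-off**: for every `R > 0`,
`|∂_μ W_R| ≤ 16/R`, `W_R(y) = smoothTransition (2 − ‖y⃗‖²/R²)`:
`∂_μ W_R = σ′(2 − ‖y⃗‖²/R²) · (−∂_μ ‖y⃗‖² / R²)` with `|σ′| ≤ 4`
(`abs_deriv_smoothTransition_le_four`), `|∂_μ ‖y⃗‖²| ≤ 2‖y⃗‖ < 4R` where `σ′ ≠ 0`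
(adapted from the far-field `abs_fderiv_spatialCutoff_le`, which assumes `R ≥ 1`). [folklore] -/
theorem morawetz_abs_fderiv_staticCutoff_le {R : ℝ} (hR : 0 < R) (x : E4) (μ : Fin 4) :
    |fderiv ℝ (fun y : E4 ↦ Real.smoothTransition (2 - E4.spatialNorm y ^ 2 / R ^ 2)) x
        (E4.basisVector μ)| ≤ 16 / R := by
  -- the inner affine-quadratic map and its derivative along `∂_μ`
  set a : E4 → ℝ := fun z ↦ 2 - E4.spatialNorm z ^ 2 / R ^ 2 with ha
  have hs0 := KerrSchild.hasFDerivAt_spatialNormSq x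
  have ha' : HasFDerivAt a (-((R ^ 2)⁻¹ • ((2 * x 1) • E4.dx 1 + (2 * x 2) • E4.dx 2 +
      (2 * x 3) • E4.dx 3))) x := by
    have h := (hs0.const_mul (R ^ 2)⁻¹).const_sub 2
    have hfun : a = fun z ↦ 2 - (R ^ 2)⁻¹ * E4.spatialNorm z ^ 2 := by
      funext z; simp only [ha]; ring
    rw [hfun]
    exact h
  have haμ : fderiv ℝ a x (E4.basisVector μ) = -((R ^ 2)⁻¹ * (if μ = 0 then 0 else 2 * x μ)) := by
    rw [ha'.fderiv]
    have hsμ := KerrSchild.fderiv_spatialNormSq_apply x μ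
    rw [hs0.fderiv] at hsμ
    simp only [neg_apply, smul_apply, smul_eq_mul, hsμ]
  have hθ : HasDerivAt Real.smoothTransition (deriv Real.smoothTransition (a x)) (a x) :=
    (((Real.smoothTransition.contDiff (n := 1)).differentiable one_ne_zero) _).hasDerivAt
  have hcomp : HasFDerivAt (fun z : E4 ↦ Real.smoothTransition (a z))
      (deriv Real.smoothTransition (a x) • -((R ^ 2)⁻¹ • ((2 * x 1) • E4.dx 1 +
        (2 * x 2) • E4.dx 2 + (2 * x 3) • E4.dx 3))) x := hθ.comp_hasFDerivAt x ha'
  have hval : fderiv ℝ (fun z : E4 ↦ Real.smoothTransition (a z)) x (E4.basisVector μ) =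
      deriv Real.smoothTransition (a x) * fderiv ℝ a x (E4.basisVector μ) := by
    rw [hcomp.fderiv, ha'.fderiv]
    simp only [smul_apply, smul_eq_mul]
  show |fderiv ℝ (fun z : E4 ↦ Real.smoothTransition (a z)) x (E4.basisVector μ)| ≤ 16 / R
  rw [hval, haμ]
  -- where `σ′ ≠ 0` we have `‖x⃗‖ < 2R`
  by_cases hfar : 2 * R ^ 2 ≤ E4.spatialNorm x ^ 2
  · have harg : a x ≤ 0 := by
      simp only [ha, sub_nonpos, le_div_iff₀ (by positivity : (0 : ℝ) < R ^ 2)]; linarith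
    have hzero : deriv Real.smoothTransition (a x) = 0 := by
      have hc : Continuous (deriv Real.smoothTransition) :=
        Real.smoothTransition.contDiff.continuous_deriv le_rfl
      have hzero' : ∀ s < (0 : ℝ), deriv Real.smoothTransition s = 0 := fun s hs ↦ by
        have hev : Real.smoothTransition =ᶠ[𝓝 s] fun _ ↦ (0 : ℝ) :=
          Filter.eventually_of_mem (Iio_mem_nhds hs) fun r hr ↦
            Real.smoothTransition.zero_of_nonpos (le_of_lt hr)
        rw [hev.deriv_eq]; simp
      have hclos : a x ∈ closure (Iio (0 : ℝ)) := by rw [closure_Iio]; exact harg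
      exact (isClosed_eq hc continuous_const).closure_subset_iff.mpr (fun s hs ↦ hzero' s hs) hclos
    rw [hzero, zero_mul, abs_zero]
    positivity
  · rw [not_le] at hfar
    have hsn : E4.spatialNorm x < 2 * R := by
      have h0 := E4.spatialNorm_nonneg x
      nlinarith
    have hxμ : |(if μ = 0 then (0 : ℝ) else 2 * x μ)| ≤ 2 * E4.spatialNorm x := by
      by_cases hμ : μ = 0
      · have h0 := E4.spatialNorm_nonneg x
        simp [hμ]; positivity
      · obtain ⟨i, rfl⟩ : ∃ i : Fin 3, μ = i.succ := ⟨μ.pred hμ, (Fin.succ_pred μ hμ).symm⟩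
        rw [if_neg hμ, abs_mul, abs_two, ← Kerr.radius_zero_left]
        exact mul_le_mul_of_nonneg_left (morawetz_abs_apply_succ_le_radius x i) zero_le_two
    calc |deriv Real.smoothTransition (a x) * -((R ^ 2)⁻¹ * (if μ = 0 then 0 else 2 * x μ))|
        = |deriv Real.smoothTransition (a x)| *
            ((R ^ 2)⁻¹ * |(if μ = 0 then (0 : ℝ) else 2 * x μ)|) := by
          rw [abs_mul, abs_neg, abs_mul, abs_of_pos (by positivity : (0 : ℝ) < (R ^ 2)⁻¹)]
      _ ≤ 4 * ((R ^ 2)⁻¹ * (2 * (2 * R))) := by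
          gcongr
          · exact abs_deriv_smoothTransition_le_four _
          · exact hxμ.trans (by linarith)
      _ = 16 / R := by field_simp; ring

/-! ### The Lagrangian weight `ϖ₂` far out -/

/-- `ϖ₂ = 2ϖ` is differentiable on `{s > 0}` with the closed-form derivative of
`hasDerivAt_morawetzWeight`. [folklore] -/
theorem morawetz_hasDerivAt_weight2 {M s : ℝ} (hM : 0 < M) (hs : 0 < s) :
    HasDerivAt (fun s : ℝ ↦ 2 * ((1 - 2 * M / s) *
        ((2 * s - 3 * M) / s ^ 2 - M ^ 3 * (s - 3 * M) ^ 2 / s ^ 6)))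
      (2 * ((-2 * s ^ 6 + 14 * M * s ^ 5 - 18 * M ^ 2 * s ^ 4 + 4 * M ^ 3 * s ^ 3 -
        40 * M ^ 4 * s ^ 2 + 126 * M ^ 5 * s - 126 * M ^ 6) / s ^ 8)) s :=
  (hasDerivAt_morawetzWeight M s hM hs).const_mul 2

/-- Monomial comparisons `0 ≤ M^k s^(6−k) ≤ s⁶/16^k` on `{16M ≤ s}`, in the form used below.
[folklore] -/
theorem morawetz_monomial_bounds {M s : ℝ} (hM : 0 < M) (hs : 16 * M ≤ s) :
    (0 ≤ M * s ^ 5 ∧ M * s ^ 5 ≤ s ^ 6 / 16) ∧ (0 ≤ M ^ 2 * s ^ 4 ∧ M ^ 2 * s ^ 4 ≤ s ^ 6 / 16 ^ 2) ∧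
      (0 ≤ M ^ 3 * s ^ 3 ∧ M ^ 3 * s ^ 3 ≤ s ^ 6 / 16 ^ 3) ∧
      (0 ≤ M ^ 4 * s ^ 2 ∧ M ^ 4 * s ^ 2 ≤ s ^ 6 / 16 ^ 4) ∧
      (0 ≤ M ^ 5 * s ∧ M ^ 5 * s ≤ s ^ 6 / 16 ^ 5) ∧ (0 ≤ M ^ 6 ∧ M ^ 6 ≤ s ^ 6 / 16 ^ 6) := by
  have hs0 : 0 < s := lt_of_lt_of_le (by positivity) hs
  have hk : ∀ k j : ℕ, M ^ k * s ^ j ≤ (s / 16) ^ k * s ^ j := fun k j ↦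
    mul_le_mul_of_nonneg_right (pow_le_pow_left₀ hM.le (by linarith) k) (by positivity)
  refine ⟨⟨by positivity, ?_⟩, ⟨by positivity, (hk 2 4).trans_eq (by ring)⟩,
    ⟨by positivity, (hk 3 3).trans_eq (by ring)⟩, ⟨by positivity, (hk 4 2).trans_eq (by ring)⟩,
    ⟨by positivity, ?_⟩, ⟨by positivity, ?_⟩⟩
  · calc M * s ^ 5 = M ^ 1 * s ^ 5 := by ring
      _ ≤ s ^ 6 / 16 := (hk 1 5).trans_eq (by ring)
  · calc M ^ 5 * s = M ^ 5 * s ^ 1 := by ring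
      _ ≤ s ^ 6 / 16 ^ 5 := (hk 5 1).trans_eq (by ring)
  · calc M ^ 6 = M ^ 6 * s ^ 0 := by ring
      _ ≤ s ^ 6 / 16 ^ 6 := (hk 6 0).trans_eq (by ring)

/-- **`|ϖ₂(s)| ≤ 6/s` for `s ≥ 16M`**: `ϖ₂ = 2N/s⁷`,
`N = 2s⁶ − 7Ms⁵ + 6M²s⁴ − M³s³ + 8M⁴s² − 21M⁵s + 18M⁶`, `|N| ≤ 3s⁶` there. [folklore] -/
theorem morawetz_abs_weight2_le {M s : ℝ} (hM : 0 < M) (hs : 16 * M ≤ s) :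
    |2 * ((1 - 2 * M / s) * ((2 * s - 3 * M) / s ^ 2 - M ^ 3 * (s - 3 * M) ^ 2 / s ^ 6))| ≤
      6 / s := by
  have hs0 : 0 < s := lt_of_lt_of_le (by positivity) hs
  obtain ⟨⟨p1, h1⟩, ⟨p2, h2⟩, ⟨p3, h3⟩, ⟨p4, h4⟩, ⟨p5, h5⟩, ⟨p6, h6⟩⟩ :=
    morawetz_monomial_bounds hM hs
  have key : 2 * ((1 - 2 * M / s) * ((2 * s - 3 * M) / s ^ 2 - M ^ 3 * (s - 3 * M) ^ 2 / s ^ 6)) =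
      2 * (2 * s ^ 6 - 7 * M * s ^ 5 + 6 * M ^ 2 * s ^ 4 - M ^ 3 * s ^ 3 + 8 * M ^ 4 * s ^ 2 -
        21 * M ^ 5 * s + 18 * M ^ 6) / s ^ 7 := by
    field_simp
    ring
  have hN : |2 * (2 * s ^ 6 - 7 * M * s ^ 5 + 6 * M ^ 2 * s ^ 4 - M ^ 3 * s ^ 3 + 8 * M ^ 4 * s ^ 2 -
      21 * M ^ 5 * s + 18 * M ^ 6)| ≤ 6 * s ^ 6 := by
    rw [abs_le]
    constructor <;> nlinarith
  rw [key, abs_div, abs_of_pos (by positivity : (0 : ℝ) < s ^ 7), div_le_div_iff₀ (by positivity) hs0]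
  calc _ ≤ 6 * s ^ 6 * s := mul_le_mul_of_nonneg_right hN hs0.le
    _ = 6 * s ^ 7 := by ring

/-- **`|ϖ₂′(s)| ≤ 8/s²` for `s ≥ 16M`** (closed form of `hasDerivAt_morawetzWeight`: numerator of
degree `6` over `s⁸`, `|numerator| ≤ 4s⁶` there). [folklore] -/
theorem morawetz_abs_weight2_deriv_le {M s : ℝ} (hM : 0 < M) (hs : 16 * M ≤ s) :
    |2 * ((-2 * s ^ 6 + 14 * M * s ^ 5 - 18 * M ^ 2 * s ^ 4 + 4 * M ^ 3 * s ^ 3 -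
        40 * M ^ 4 * s ^ 2 + 126 * M ^ 5 * s - 126 * M ^ 6) / s ^ 8)| ≤ 8 / s ^ 2 := by
  have hs0 : 0 < s := lt_of_lt_of_le (by positivity) hs
  obtain ⟨⟨p1, h1⟩, ⟨p2, h2⟩, ⟨p3, h3⟩, ⟨p4, h4⟩, ⟨p5, h5⟩, ⟨p6, h6⟩⟩ :=
    morawetz_monomial_bounds hM hs
  have hN : |2 * (-2 * s ^ 6 + 14 * M * s ^ 5 - 18 * M ^ 2 * s ^ 4 + 4 * M ^ 3 * s ^ 3 -
      40 * M ^ 4 * s ^ 2 + 126 * M ^ 5 * s - 126 * M ^ 6)| ≤ 8 * s ^ 6 := by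
    rw [abs_le]
    constructor <;> nlinarith
  rw [mul_div_assoc', abs_div, abs_of_pos (by positivity : (0 : ℝ) < s ^ 8),
    div_le_div_iff₀ (by positivity) (by positivity : (0 : ℝ) < s ^ 2)]
  calc _ ≤ 8 * s ^ 6 * s ^ 2 := mul_le_mul_of_nonneg_right hN (by positivity)
    _ = 8 * s ^ 8 := by ring

/-! ### Pointwise bounds at a flat point -/

/-- The radial covector `x¹dx¹ + x²dx² + x³dx³` has components of modulus `≤ r(x)`. [folklore] -/
theorem morawetz_abs_radCovector_basisVector_le (x : E4) (μ : Fin 4) :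
    |((x 1) • E4.dx 1 + (x 2) • E4.dx 2 + (x 3) • E4.dx 3) (E4.basisVector μ)| ≤
      Kerr.radius 0 x := by
  have h1 := morawetz_abs_apply_succ_le_radius x 0
  have h2 := morawetz_abs_apply_succ_le_radius x 1
  have h3 := morawetz_abs_apply_succ_le_radius x 2
  have h0 := Kerr.radius_nonneg 0 x
  simp only [Fin.succ_zero_eq_one, Fin.succ_one_eq_two, show (2 : Fin 3).succ = 3 from rfl] at h1 h2 h3
  simp only [add_apply, smul_apply, Kerr.dx_basisVector, smul_eq_mul]
  fin_cases μ <;> simpa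

/-- **The components of the radial multiplier `X = (1 − 3M/r) ∂_{r*}` have modulus `≤ 1` on
`{16M ≤ r}`** (there `χ(r) = 0`: `X⁰ = 0`, `Xⁱ = (1 − 3M/r) xⁱ/r`). [folklore] -/
theorem morawetz_abs_radialLeg_le_one {M : ℝ} {x : E4} (hM : 0 < M) (h16 : 16 * M ≤ Kerr.radius 0 x)
    (α : Fin 4) :
    |(if α = 0 then (1 - 3 * M / Kerr.radius 0 x) *
          (Real.smoothTransition (2 - Kerr.radius 0 x / (8 * M)) * (2 * Kerr.scalarH M 0 x))
        else (1 - 3 * M / Kerr.radius 0 x) *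
          (1 - (Real.smoothTransition (2 - Kerr.radius 0 x / (8 * M)) * (2 * Kerr.scalarH M 0 x))) *
            x α / Kerr.radius 0 x)| ≤ 1 := by
  have hr0 : 0 < Kerr.radius 0 x := lt_of_lt_of_le (by positivity) h16
  rw [cruxCutoff_eq_zero hM h16]
  simp only [zero_mul, mul_zero, sub_zero, mul_one]
  split_ifs with hα
  · simp
  · obtain ⟨i, rfl⟩ : ∃ i : Fin 3, α = i.succ := ⟨α.pred hα, (Fin.succ_pred α hα).symm⟩
    have hxi := morawetz_abs_apply_succ_le_radius x i
    have hF : |1 - 3 * M / Kerr.radius 0 x| ≤ 1 := by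
      have h1 : 3 * M / Kerr.radius 0 x ≤ 1 := by rw [div_le_one hr0]; linarith
      have h2 : 0 ≤ 3 * M / Kerr.radius 0 x := by positivity
      rw [abs_le]; constructor <;> linarith
    rw [abs_div, abs_mul, abs_of_pos hr0, div_le_one hr0]
    calc |1 - 3 * M / Kerr.radius 0 x| * |x i.succ| ≤ 1 * Kerr.radius 0 x :=
        mul_le_mul hF hxi (abs_nonneg _) zero_le_one
      _ = Kerr.radius 0 x := one_mul _

/-- **Pointwise bound for the total Morawetz current at a flat point.** If at `x` (with
`r = r(x) > 0`) the coefficients are Minkowski's, the multiplier has components of modulus `≤ 1`,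
the Lagrangian weight is radial, `ϖ = w ∘ r` with `|w(r)| ≤ A/r`, `|w′(r)| ≤ B/r²`, and the Hardy
profile vanishes (`h = 0`), then for every `μ`
`|J^X + ¼ L^ϖ + ½ h Φ² V + J^T|^μ ≤ 8 ∑_κ (∂_κΦ)² + (A² + B)/8 · Φ²/r²`
(flat-space bounds `|(J^Y)^μ| ≤ (3/2)(∑|Y^α|) ∑(∂Φ)²`, `|L^μ| ≤ ½∑(∂Φ)² + ½ϖ²Φ² + ½Φ²|∂_μϖ|`,
and `|∂_μ (w ∘ r)| = |w′(r)| |x_μ|/r ≤ |w′(r)|`). [folklore] -/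
theorem morawetz_abs_totalCurrent_flat_le {G : E4 → Fin 4 → Fin 4 → ℝ} {X : E4 → Fin 4 → ℝ}
    {ϖ Φ : E4 → ℝ} {x : E4} {V : Fin 4 → ℝ} {w : ℝ → ℝ} {h r A B : ℝ}
    (hr : Kerr.radius 0 x = r) (h0 : 0 < r)
    (hG : ∀ μ ν, G x μ ν = Kerr.etaComp μ ν) (hX : ∀ α, |X x α| ≤ 1)
    (hϖ : ϖ = fun z ↦ w (Kerr.radius 0 z)) (hw : DifferentiableAt ℝ w r) (hwr : |w r| ≤ A / r)
    (hw' : |deriv w r| ≤ B / r ^ 2) (hh : h = 0) (μ : Fin 4) :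
    |KerrSchild.multiplierCurrent G X Φ x μ + 4⁻¹ * KerrSchild.lagrangianCurrent G ϖ Φ x μ +
        2⁻¹ * h * Φ x ^ 2 * V μ + KerrSchild.multiplierCurrent G KerrSchild.timeField Φ x μ| ≤
      8 * (∑ κ, fderiv ℝ Φ x (E4.basisVector κ) ^ 2) + (A ^ 2 + B) / 8 * (Φ x ^ 2 / r ^ 2) := by
  subst hh
  set P := ∑ κ, fderiv ℝ Φ x (E4.basisVector κ) ^ 2 with hP
  have hP0 : 0 ≤ P := Finset.sum_nonneg fun _ _ ↦ sq_nonneg _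
  -- at `x` the coefficients are Minkowski's
  have hJX : KerrSchild.multiplierCurrent G X Φ x μ =
      KerrSchild.multiplierCurrent (fun _ ↦ Kerr.etaComp) X Φ x μ := by
    simp only [KerrSchild.multiplierCurrent, hG]
  have hJT : KerrSchild.multiplierCurrent G KerrSchild.timeField Φ x μ =
      KerrSchild.multiplierCurrent (fun _ ↦ Kerr.etaComp) KerrSchild.timeField Φ x μ := by
    simp only [KerrSchild.multiplierCurrent, hG]
  have hL : KerrSchild.lagrangianCurrent G ϖ Φ x μ =
      KerrSchild.lagrangianCurrent (fun _ ↦ Kerr.etaComp) ϖ Φ x μ := by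
    simp only [KerrSchild.lagrangianCurrent, hG]
  -- `|J^X| ≤ 6 P`
  have h1 : |KerrSchild.multiplierCurrent (fun _ ↦ Kerr.etaComp) X Φ x μ| ≤ 6 * P := by
    have hS : ∑ α, |X x α| ≤ 4 := by
      calc ∑ α, |X x α| ≤ ∑ _α : Fin 4, (1 : ℝ) := Finset.sum_le_sum fun α _ ↦ hX α
        _ = 4 := by simp
    calc _ ≤ 3 / 2 * (∑ α, |X x α|) * P := abs_multiplierCurrent_eta_le X Φ x μ
      _ ≤ 3 / 2 * 4 * P := by gcongr
      _ = 6 * P := by ring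
  -- `|J^T| ≤ 3/2 P`
  have h2 : |KerrSchild.multiplierCurrent (fun _ ↦ Kerr.etaComp) KerrSchild.timeField Φ x μ| ≤
      3 / 2 * P := by
    have hS : ∑ α, |KerrSchild.timeField x α| = 1 := by
      simp [Fin.sum_univ_four, KerrSchild.timeField]
    calc _ ≤ 3 / 2 * (∑ α, |KerrSchild.timeField x α|) * P :=
          abs_multiplierCurrent_eta_le _ Φ x μ
      _ = 3 / 2 * P := by rw [hS, mul_one]
  -- the weight and its gradient at `x`
  have hϖx : ϖ x = w r := by simp only [hϖ, hr]
  have hϖsq : ϖ x ^ 2 ≤ A ^ 2 / r ^ 2 := by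
    rw [← sq_abs, ← div_pow]
    exact pow_le_pow_left₀ (abs_nonneg _) (by rw [hϖx]; exact hwr) 2
  have hfd : fderiv ℝ ϖ x =
      (deriv w r * r⁻¹) • ((x 1) • E4.dx 1 + (x 2) • E4.dx 2 + (x 3) • E4.dx 3) := by
    rw [hϖ]
    exact (hardy_hasFDerivAt_comp_radius hr h0 hw.hasDerivAt).fderiv
  have hdϖ : |fderiv ℝ ϖ x (E4.basisVector μ)| ≤ B / r ^ 2 := by
    have hLμ := morawetz_abs_radCovector_basisVector_le x μ
    rw [hr] at hLμ
    rw [hfd, smul_apply, smul_eq_mul, abs_mul, abs_mul, abs_of_pos (inv_pos.2 h0)]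
    calc |deriv w r| * r⁻¹ * |((x 1) • E4.dx 1 + (x 2) • E4.dx 2 + (x 3) • E4.dx 3) (E4.basisVector μ)|
        ≤ B / r ^ 2 * r⁻¹ * r := by
          refine mul_le_mul (mul_le_mul_of_nonneg_right hw' (inv_nonneg.2 h0.le)) hLμ
            (abs_nonneg _) ?_
          exact mul_nonneg ((abs_nonneg _).trans hw') (inv_nonneg.2 h0.le)
      _ = B / r ^ 2 := by field_simp
  -- `|L| ≤ ½ P + ½ A² Φ²/r² + ½ B Φ²/r²`
  have h3 : |KerrSchild.lagrangianCurrent (fun _ ↦ Kerr.etaComp) ϖ Φ x μ| ≤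
      2⁻¹ * P + 2⁻¹ * (A ^ 2 * (Φ x ^ 2 / r ^ 2)) + 2⁻¹ * (B * (Φ x ^ 2 / r ^ 2)) := by
    have key := abs_lagrangianCurrent_eta_le ϖ Φ x μ
    rw [← hP] at key
    have e1 : ϖ x ^ 2 * Φ x ^ 2 ≤ A ^ 2 * (Φ x ^ 2 / r ^ 2) := by
      calc ϖ x ^ 2 * Φ x ^ 2 ≤ A ^ 2 / r ^ 2 * Φ x ^ 2 :=
          mul_le_mul_of_nonneg_right hϖsq (sq_nonneg _)
        _ = A ^ 2 * (Φ x ^ 2 / r ^ 2) := by ring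
    have e2 : Φ x ^ 2 * |fderiv ℝ ϖ x (E4.basisVector μ)| ≤ B * (Φ x ^ 2 / r ^ 2) := by
      calc Φ x ^ 2 * |fderiv ℝ ϖ x (E4.basisVector μ)| ≤ Φ x ^ 2 * (B / r ^ 2) :=
          mul_le_mul_of_nonneg_left hdϖ (sq_nonneg _)
        _ = B * (Φ x ^ 2 / r ^ 2) := by ring
    linarith
  -- assemble
  simp only [hJX, hJT, hL, mul_zero, zero_mul, add_zero]
  have hQ0 : 0 ≤ Φ x ^ 2 / r ^ 2 := by positivity
  have hA0 : 0 ≤ A ^ 2 * (Φ x ^ 2 / r ^ 2) := by positivity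
  have e : (A ^ 2 + B) / 8 * (Φ x ^ 2 / r ^ 2) =
      8⁻¹ * (A ^ 2 * (Φ x ^ 2 / r ^ 2)) + 8⁻¹ * (B * (Φ x ^ 2 / r ^ 2)) := by ring
  refine (abs_add_three _ _ _).trans ?_
  rw [abs_mul, abs_of_pos (by norm_num : (0 : ℝ) < 4⁻¹), e]
  linarith

/-- `|∑_μ D_μ J^μ| ≤ 4 d j` on `Fin 4` when `|D_μ| ≤ d` and `|J^μ| ≤ j`. [folklore] -/
theorem morawetz_abs_sum_mul_le_four {D J : Fin 4 → ℝ} {d j : ℝ} (hD : ∀ μ, |D μ| ≤ d)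
    (hJ : ∀ μ, |J μ| ≤ j) : |∑ μ, D μ * J μ| ≤ 4 * d * j := by
  have hd : 0 ≤ d := (abs_nonneg _).trans (hD 0)
  calc |∑ μ, D μ * J μ| ≤ ∑ μ, |D μ * J μ| := Finset.abs_sum_le_sum_abs _ _
    _ ≤ ∑ _μ : Fin 4, d * j := Finset.sum_le_sum fun μ _ ↦ by
        rw [abs_mul]; exact mul_le_mul (hD μ) (hJ μ) (abs_nonneg _) hd
    _ = 4 * d * j := by simp [Finset.sum_const, Finset.card_univ, Fintype.card_fin]; ring

/-- **The cut-off layer, abstract form**: with `|D_μ| ≤ d` for the cut-off gradient and the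
hypotheses of `morawetz_abs_totalCurrent_flat_le` at the point,
`|∑_μ D_μ J_tot^μ| ≤ 4 d (8 + (A² + B)/8) (∑_κ (∂_κΦ)² + Φ²/r²)`. [folklore] -/
theorem morawetz_abs_sum_cutoff_mul_current_le {G : E4 → Fin 4 → Fin 4 → ℝ}
    {X : E4 → Fin 4 → ℝ} {ϖ Φ : E4 → ℝ} {x : E4} {D V : Fin 4 → ℝ} {w : ℝ → ℝ}
    {h r d A B : ℝ} (hr : Kerr.radius 0 x = r) (h0 : 0 < r) (hB : 0 ≤ B)
    (hD : ∀ μ, |D μ| ≤ d)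
    (hG : ∀ μ ν, G x μ ν = Kerr.etaComp μ ν) (hX : ∀ α, |X x α| ≤ 1)
    (hϖ : ϖ = fun z ↦ w (Kerr.radius 0 z)) (hw : DifferentiableAt ℝ w r) (hwr : |w r| ≤ A / r)
    (hw' : |deriv w r| ≤ B / r ^ 2) (hh : h = 0) :
    |∑ μ, D μ * (KerrSchild.multiplierCurrent G X Φ x μ +
        4⁻¹ * KerrSchild.lagrangianCurrent G ϖ Φ x μ + 2⁻¹ * h * Φ x ^ 2 * V μ +
        KerrSchild.multiplierCurrent G KerrSchild.timeField Φ x μ)| ≤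
      4 * d * (8 + (A ^ 2 + B) / 8) *
        (∑ κ, fderiv ℝ Φ x (E4.basisVector κ) ^ 2 + Φ x ^ 2 / r ^ 2) := by
  have hP0 : 0 ≤ ∑ κ, fderiv ℝ Φ x (E4.basisVector κ) ^ 2 := Finset.sum_nonneg fun _ _ ↦ sq_nonneg _
  have hQ0 : 0 ≤ Φ x ^ 2 / r ^ 2 := by positivity
  have hc0 : 0 ≤ (A ^ 2 + B) / 8 := by positivity
  have hJ : ∀ μ, |KerrSchild.multiplierCurrent G X Φ x μ +
      4⁻¹ * KerrSchild.lagrangianCurrent G ϖ Φ x μ + 2⁻¹ * h * Φ x ^ 2 * V μ +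
      KerrSchild.multiplierCurrent G KerrSchild.timeField Φ x μ| ≤
      (8 + (A ^ 2 + B) / 8) * (∑ κ, fderiv ℝ Φ x (E4.basisVector κ) ^ 2 + Φ x ^ 2 / r ^ 2) := by
    intro μ
    refine (morawetz_abs_totalCurrent_flat_le hr h0 hG hX hϖ hw hwr hw' hh μ).trans ?_
    nlinarith [mul_nonneg hc0 hP0, hQ0]
  calc _ ≤ 4 * d * ((8 + (A ^ 2 + B) / 8) *
        (∑ κ, fderiv ℝ Φ x (E4.basisVector κ) ^ 2 + Φ x ^ 2 / r ^ 2)) :=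
        morawetz_abs_sum_mul_le_four hD hJ
    _ = _ := by ring

/-! ### The registered stub -/

/-- **Stub `morawetz_staticLayer_abs_le`** (crux `AdiabaticMultiKerrILED`, line `Sketch`): the error
term of the static spatial cut-off `W_R = σ(2 − ‖x⃗‖²/R²)` in the weighted Morawetz identity of the
static tails-cut Schwarzschild zone is bounded by `K/R` times the pointwise energy density
`∑_μ (∂_μΦ)² + Φ²/r²` on the support `{R ≤ ‖x⃗‖}` of `dW_R` (`R ≥ 16M`, where the zone is flat).
Dafermos–Rodnianski arXiv:0811.0354, §4.1 (cut-off errors of the `X`-estimate). [folklore] -/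
theorem morawetz_staticLayer_abs_le : ∀ (M : ℝ), 0 < M → ∃ K : ℝ, 0 ≤ K ∧ ∀ (R : ℝ) (Φ : E4 → ℝ) (x : E4), 16 * M ≤ R → R ≤ E4.spatialNorm x →
    |∑ μ, fderiv ℝ (fun y : E4 ↦ Real.smoothTransition (2 - E4.spatialNorm y ^ 2 / R ^ 2)) x (E4.basisVector μ) * (KerrSchild.multiplierCurrent (KerrSchild.inverseMetric (fun y ↦ Real.smoothTransition (2 - Kerr.radius 0 y / (8 * M)) * (2 * Kerr.scalarH M 0 y)) (Kerr.nullVector 0)) (fun (z : E4) (α : Fin 4) ↦ if α = 0 then (1 - 3 * M / Kerr.radius 0 z) * (Real.smoothTransition (2 - Kerr.radius 0 z / (8 * M)) * (2 * Kerr.scalarH M 0 z))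
          else (1 - 3 * M / Kerr.radius 0 z) * (1 - (Real.smoothTransition (2 - Kerr.radius 0 z / (8 * M)) * (2 * Kerr.scalarH M 0 z))) * z α / Kerr.radius 0 z) Φ x μ +
        4⁻¹ * KerrSchild.lagrangianCurrent (KerrSchild.inverseMetric (fun y ↦ Real.smoothTransition (2 - Kerr.radius 0 y / (8 * M)) * (2 * Kerr.scalarH M 0 y)) (Kerr.nullVector 0)) (fun z ↦ (fun s ↦ 2 * ((1 - 2 * M / s) * ((2 * s - 3 * M) / s ^ 2 - M ^ 3 * (s - 3 * M) ^ 2 / s ^ 6))) (Kerr.radius 0 z)) Φ x μ +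
        2⁻¹ * (fun s ↦ if s ≤ 7 * M then 2 * (7 * M - s) ^ 2 * (fun ρ ↦ (-((593459 : ℝ) / 10000000)) + (788874 : ℝ) / 10000000 * ρ - (383061 : ℝ) / 10000000 * ρ ^ 2 + (92031 : ℝ) / 10000000 * ρ ^ 3 - (10985 : ℝ) / 10000000 * ρ ^ 4 + (525 : ℝ) / 10000000 * ρ ^ 5) (s / M) / (M ^ 3 * s) else 0) (Kerr.radius 0 x) * Φ x ^ 2 * (if μ = 0 then (Real.smoothTransition (2 - Kerr.radius 0 x / (8 * M)) * (2 * Kerr.scalarH M 0 x)) else (1 - (Real.smoothTransition (2 - Kerr.radius 0 x / (8 * M)) * (2 * Kerr.scalarH M 0 x))) * x μ / Kerr.radius 0 x) +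
        KerrSchild.multiplierCurrent (KerrSchild.inverseMetric (fun y ↦ Real.smoothTransition (2 - Kerr.radius 0 y / (8 * M)) * (2 * Kerr.scalarH M 0 y)) (Kerr.nullVector 0)) KerrSchild.timeField Φ x μ)| ≤
      K / R * (∑ μ, fderiv ℝ Φ x (E4.basisVector μ) ^ 2 + Φ x ^ 2 / Kerr.radius 0 x ^ 2) := by
  intro M hM
  refine ⟨4 * 16 * (8 + (6 ^ 2 + 8) / 8), by norm_num, ?_⟩
  intro R Φ x hR hx
  have hRpos : 0 < R := lt_of_lt_of_le (by positivity) hR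
  have h16 : 16 * M ≤ Kerr.radius 0 x := by
    rw [Kerr.radius_zero_left]; exact hR.trans hx
  have hr0 : 0 < Kerr.radius 0 x := lt_of_lt_of_le (by positivity) h16
  have h7 : 7 * M < Kerr.radius 0 x := by linarith
  refine le_trans (morawetz_abs_sum_cutoff_mul_current_le (A := 6) (B := 8) (d := 16 / R)
    (w := fun s ↦ 2 * ((1 - 2 * M / s) * ((2 * s - 3 * M) / s ^ 2 - M ^ 3 * (s - 3 * M) ^ 2 / s ^ 6)))
    rfl hr0 (by norm_num) ?_ ?_ ?_ rfl ?_ ?_ ?_ ?_) (le_of_eq ?_)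
  · exact fun μ ↦ morawetz_abs_fderiv_staticCutoff_le hRpos x μ
  · exact fun μ ν ↦ KerrSchild.inverseMetric_of_eq_zero _
      (tailsCut_profile_eq_zero_of_le_radius M 0 x hM h16) μ ν
  · exact fun α ↦ morawetz_abs_radialLeg_le_one hM h16 α
  · exact (morawetz_hasDerivAt_weight2 hM hr0).differentiableAt
  · exact morawetz_abs_weight2_le hM h16
  · rw [(morawetz_hasDerivAt_weight2 hM hr0).deriv]
    exact morawetz_abs_weight2_deriv_le hM h16
  · exact if_neg (not_le.mpr h7)
  · ring

end Summit.FinalStateConjecture.FinalStateConjecture.Theorems
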